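import Summits.BirchSwinnertonDyer.Rank1Residual.Additive.GordRankOneKatoBranchGrossZagier
import HarnessLib

/-!
# The (G)-cell at analytic rank ONE, defect 2, `p ≡ 1 (mod 4)` — X3♯(G-ord) twin (reducible `E[p]`,
# Wuthrich 2014 Thm. 16 in place of Kato): the UPPER HALF of `BSD(E,p)` at rank one from [Wuthrich +
# typed branch p-adic Gross–Zagier], `BSD(E,p)` from one unit certificate, and
# `BranchPAdicGrossZagierAt ⟺ BSD(E,p)` on the unit-certified rows — NO Kolyvagin anywhere
# (cell `b2b-bsdres`, sub-cell additive-p2, gen 19; sequel of `GordRankOneKatoBranchGrossZagier`)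

HONEST FRAMING (cell `b2b-bsdres`, run/shared/lean/b2b/bsd-rank1-residual/, verbatim in every
file): the goal of the cell is to DELETE the COMBINATION-SHAPED residual classes of the
Birch–Swinnerton-Dyer formula for ALL analytic-rank `≤ 1` elliptic curves over `ℚ` — "full BSD
formula for every rank `≤ 1` curve in class `C`" assembled STRICTLY from published theorems — so
that the rank-`≤ 1` remainder becomes exactly the CONSTRUCTION-SHAPED classes, which are TYPED
(missing-input `Prop`s), NOT attempted. This is not "finishing BSD". Sub-cell `additive-p2`
(CLASS-OWNERS row "X3/X4 additive — pot. good ordinary / X3♯(G-ord)"), generation 19: research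
route; no claim beyond the stated classes; X3♯(G-ord)/X4♯(G-ord) stay CONSTRUCTION-SHAPED; labels /
census / located gap UNCHANGED; nothing is booked. Theorems only (no definition, no new named fact;
named facts enter as HYPOTHESES: the semistable reducible half-eigenspace reading of Wuthrich 2014
Thm. 16 (`Wuthrich2014.thm16_halfEigenCharIdeal_dvd_cyclotomicPrime`), Delbourgo 2002 (A)+(B) = A175,
Pal 2012 Thm. 3.2, GZK, modularity; the TYPED input is team n1011's `BranchPAdicGrossZagierAt W p Dh`,
OPEN at rank one — RESIDUAL-MAP §I O7-ord).

What: the three theorems of `GordRankOneKatoBranchGrossZagier.lean` with `ClassX4Gord ∧ Surj` replaced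
by `ClassX3Gord` (reducible `E[p]`; `E♭[p]` reducible too) and Kato's component reading by Wuthrich's:
`ClassX3Gord.missingUpperBoundAt_rankOne_of_wuthrichHalf_of_branchPAdicGrossZagier` (upper half at
rank one on EVERY X3♯(G-ord) ∩ I₀* row with a simple analytic zero, `p ≡ 1 (mod 4)`, `p ≥ 5` — on X3
there is NO Kolyvagin route, so this is the only printed-input path to an upper half at rank one),
`ClassX3Gord.bsdp_rankOne_of_wuthrichHalf_of_cert_of_branchPAdicGrossZagier`,
`ClassX3Gord.branchPAdicGrossZagierAt_iff_bsdp_of_wuthrichHalf_of_cert`. Nothing booked; labels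
UNCHANGED.

References: [Wuthrich2014] Thm. 16; [Delbourgo2002] Thm. (A), (B); [PerrinRiou1987] §1.4;
[SteinWuthrich2013] §4; [Pal2012] Thm. 3.2; [Miller2011LMS] Def. 1.1.
-/

noncomputable section

open scoped Classical MatrixGroups ModularForm NumberField

namespace Summit.BirchSwinnertonDyer.Rank1Residual.Additive

open CongruenceSubgroup WeierstrassCurve NumberField Literature.NumberTheory.EllipticCurves
  Literature.NumberTheory.EllipticCurves.ModularForms
  Literature.NumberTheory.EllipticCurves.Rank1Residual
  Literature.NumberTheory.EllipticCurves.Rank1Residual.Typed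
  Literature.NumberTheory.EllipticCurves.Delbourgo2002
  Literature.NumberTheory.GaloisRepresentations Summit.BirchSwinnertonDyer.Rank1Residual.AdditivePotMult
  Summit.BirchSwinnertonDyer.Rank1Residual.X1.MuLambda
  Summit.BirchSwinnertonDyer.Rank1Residual.X1.RankOneParitySqueeze
  IsDedekindDomain

variable {W : WeierstrassCurve ℚ} [W.IsElliptic] [W.IsGloballyMinimal] {p : ℕ} [hp : Fact p.Prime]

/-! ### §1 Wuthrich + branch `p`-adic Gross–Zagier ⟹ the UPPER half at rank one on X3♯(G-ord) -/

/-- **X3♯(G-ord) ∩ `I₀*`, `p ≡ 1 (mod 4)`, `r_an = 1`: the UPPER HALF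
`ord_p #Ш(E) ≤ ord_p #Ш_an(E)` from Wuthrich's divisibility and the typed branch `p`-adic Gross–Zagier for
ONE (B)-datum** (+ the weak certificate `[T¹](ϖ·B) ≠ 0`; GZK, modularity published; A175 supplies
such a `Dh` on the cell). Every row, anomalous or not. [cite: Wuthrich2014, Thm. 16 (p. 397)]
[cite: Delbourgo2002, Theorem (A), (B) (p. 40)] [cite: SteinWuthrich2013, §4 (good ordinary template)]
[cite: Miller2011LMS, Def. 1.1] -/
theorem ClassX3Gord.missingUpperBoundAt_rankOne_of_wuthrichHalf_of_branchPAdicGrossZagier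
    (hWu : Wuthrich2014.thm16_halfEigenCharIdeal_dvd_cyclotomicPrime)
    (hmodD : nonempty_modularParametrizationData)
    (hGZK : rank_eq_analyticRank_of_analyticRank_le_one) (hmod : hasEntireLFunction_rat)
    (hX : ClassX3Gord W p) (hp4 : p % 4 = 1)
    (he : semistabilityIndex W p = 2) (hr : W.analyticRank = 1)
    (hne : BranchCoeffOneNeZeroAt W p)
    (hGZ : ∃ Dh : PAdicHeightData W p, LeadingTermClauses W p Dh ∧ BranchPAdicGrossZagierAt W p Dh) :
    MissingUpperBoundAt W p := by
  have hpP : p.Prime := hp.out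
  obtain ⟨Dh, hB, hGZDh⟩ := hGZ
  obtain ⟨hps, heven⟩ := pStar_eq_and_even_of_mod_four_eq_one (p := p) hp4
  -- the twist datum
  obtain ⟨V, iV, iVm, C, hV, hC⟩ := hX.exists_goodOrd_pStar_twist_model W p (by omega) he
  haveI : NeZero (V.conductorNorm ℤ) := ⟨(V.conductorNorm_pos_holds).ne'⟩
  obtain ⟨Dm⟩ := hmodD V
  obtain ⟨ϖ, -, hϖ, -⟩ := Dm.exists_rat_mul_realPeriodRat_eq_plusPeriod
  have hϖ' : (if Even (p / 2) then (ϖ : ℝ) * V.realPeriodRat = plusPeriod Dm.f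
      else (ϖ : ℝ) * V.imaginaryPeriodRat = minusPeriod Dm.f) := by rw [if_pos heven]; exact hϖ
  have hord : IsOrdinaryAt V p :=
    isOrdinaryAt_of_goodOrd_or_mult_of_model_twist W V (pStar_ne_zero p) ⟨C, hC⟩
      (padicValRat_j_nonneg_of_typeGOrd W p hX.typeGOrd) (Or.inl hV)
  have hne' := hne V C hC hord Dm.f Dm.isNewformOf ϖ hϖ'
  -- file 4: Schneider and the Kato-type bound
  obtain ⟨hS, ℓ, -, -, hle⟩ := hX.schneider_and_padicVal_le_rankOne_of_wuthrichHalf hWu hGZK (by omega) hr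
    V C hC hV Dm.isNewformOf ϖ hϖ' hne' hB
  rw [if_pos heven] at hle hne'
  -- branch p-adic Gross–Zagier at rank 1
  obtain ⟨hmw, hfinSha⟩ := hGZK W (by rw [hr])
  have hr1 : W.mordellWeilRank = 1 := by rw [hmw, hr]
  haveI : Finite W.sha := hfinSha
  have hVW : ∃ C : VariableChange ℚ, C • V.quadraticTwist (p : ℚ) = W := ⟨C, by rw [← hps]; exact hC⟩
  obtain ⟨u, q, hLq, hgz⟩ := hGZDh V hp4 hVW hV Dm.isNewformOf ϖ hϖ
  rw [hr1, pow_one] at hgz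
  -- valuations
  have hq0 : q ≠ 0 := by
    rintro rfl
    rw [Rat.cast_zero, zero_mul, zero_mul] at hLq
    exact W.leadingLCoeff_ne_zero_holds (hmod W) hLq
  have hqQ : ((q : ℚ) : ℚ_[p]) ≠ 0 := by exact_mod_cast hq0
  have hReg : padicRegulator Dh ≠ 0 := hS
  have hu0 : ((u : ℤ_[p]) : ℚ_[p]) ≠ 0 := coe_units_ne_zero p u
  obtain ⟨w, hw⟩ := exists_unit_padicLog_cyclotomicGenerator (p := p) (by omega)
  have hpQ : (p : ℚ_[p]) ≠ 0 := by exact_mod_cast hpP.ne_zero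
  have hlog0 : padicLog p (cyclotomicGenerator p : ℚ_[p]) ≠ 0 := by
    rw [hw]; exact mul_ne_zero hpQ (coe_units_ne_zero p w)
  have hlogv : (padicLog p (cyclotomicGenerator p : ℚ_[p])).valuation = 1 := by
    rw [hw, Padic.valuation_mul hpQ (coe_units_ne_zero p w), Padic.valuation_p,
      valuation_coe_units_eq_zero, add_zero]
  have hcoef : PowerSeries.coeff 1 (PowerSeries.C (ϖ : ℚ_[p]) *
      padicLFunctionBranch Dm.f ((unitRoot V p : ℤ_[p]) : ℚ_[p]) (p / 2)) =
      (ϖ : ℚ_[p]) * PowerSeries.coeff 1 (padicLFunctionBranch Dm.f ((unitRoot V p : ℤ_[p]) : ℚ_[p])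
        (p / 2)) := PowerSeries.coeff_C_mul _ _ _
  rw [hcoef] at hle hne'
  have hval := congrArg Padic.valuation hgz
  rw [Padic.valuation_mul hne' hlog0, hlogv, Padic.valuation_mul (mul_ne_zero hu0 hqQ) hReg,
    Padic.valuation_mul hu0 hqQ, valuation_coe_units_eq_zero, zero_add, Padic.valuation_ratCast] at hval
  -- `#Ш_an = q·#T²/∏c`
  have hsha := shaAn_eq_of_leadingLCoeff_eq W hLq
  have hT0 : (W.torsionOrder : ℚ) ≠ 0 := by exact_mod_cast (W.torsionOrder_pos_holds).ne'
  have hP0 : (W.tamagawaProduct : ℚ) ≠ 0 := by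
    exact_mod_cast (W.tamagawaProduct_pos_holds : 0 < W.tamagawaProduct).ne'
  have hvq : padicValRat p (q * (W.torsionOrder : ℚ) ^ 2 / (W.tamagawaProduct : ℚ)) =
      padicValRat p q + 2 * padicValNat p W.torsionOrder - padicValNat p W.tamagawaProduct := by
    rw [padicValRat.div (mul_ne_zero hq0 (pow_ne_zero 2 hT0)) hP0,
      padicValRat.mul hq0 (pow_ne_zero 2 hT0), padicValRat.pow, padicValRat.of_nat,
      padicValRat.of_nat]
    push_cast
    ring
  refine ⟨_, hsha, ?_⟩
  rw [hvq]
  have hℓ : (0 : ℤ) ≤ padicValNat p ℓ := by exact_mod_cast Nat.zero_le _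
  linarith

/-! ### §2 Unit certificate: Wuthrich + branch `p`-adic Gross–Zagier ⟹ `BSD(E,p)` off the anomalous rows -/

/-- **X3♯(G-ord) ∩ `I₀*`, `p ≡ 1 (mod 4)`, `p ≥ 5`, `E` non-CM, `r_an = 1`, non-anomalous,
UNIT certificate: Wuthrich's divisibility and the typed branch `p`-adic Gross–Zagier for ONE (B)-datum
give `BSD(E,p)`** (reducible `E[p]`: NO Kolyvagin anywhere) — no main conjecture: `ord(ϖ·[T¹]B) = 0` and pGZ pin `ord q + ord Reg_p(Dh) = 1`,
which is `GordRankOneKatoCertificateBSD`'s criterion. [cite: Wuthrich2014, Thm. 16 (p. 397)]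
[cite: Delbourgo2002, Theorem (A), (B) (p. 40)] [cite: Miller2011LMS, Def. 1.1] -/
theorem ClassX3Gord.bsdp_rankOne_of_wuthrichHalf_of_cert_of_branchPAdicGrossZagier
    (hWu : Wuthrich2014.thm16_halfEigenCharIdeal_dvd_cyclotomicPrime)
    (hmodD : nonempty_modularParametrizationData)
    (hGZK : rank_eq_analyticRank_of_analyticRank_le_one) (hmod : hasEntireLFunction_rat)
    (hX : ClassX3Gord W p) (hp4 : p % 4 = 1) (hp5 : 5 ≤ p)
    (he : semistabilityIndex W p = 2) (hr : W.analyticRank = 1)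
    (hna : ReductionNonAnomalous W p) (hcert : BranchUnitCertificateAt W p)
    {Dh : PAdicHeightData W p} (hB : LeadingTermClauses W p Dh) (hGZ : BranchPAdicGrossZagierAt W p Dh) :
    BSDp W p := by
  have hpP : p.Prime := hp.out
  obtain ⟨hps, heven⟩ := pStar_eq_and_even_of_mod_four_eq_one (p := p) hp4
  obtain ⟨V, iV, iVm, C, hV, hC⟩ := hX.exists_goodOrd_pStar_twist_model W p (by omega) he
  haveI : NeZero (V.conductorNorm ℤ) := ⟨(V.conductorNorm_pos_holds).ne'⟩
  obtain ⟨Dm⟩ := hmodD V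
  obtain ⟨ϖ, -, hϖ, -⟩ := Dm.exists_rat_mul_realPeriodRat_eq_plusPeriod
  have hϖ' : (if Even (p / 2) then (ϖ : ℝ) * V.realPeriodRat = plusPeriod Dm.f
      else (ϖ : ℝ) * V.imaginaryPeriodRat = minusPeriod Dm.f) := by rw [if_pos heven]; exact hϖ
  have hord : IsOrdinaryAt V p :=
    isOrdinaryAt_of_goodOrd_or_mult_of_model_twist W V (pStar_ne_zero p) ⟨C, hC⟩
      (padicValRat_j_nonneg_of_typeGOrd W p hX.typeGOrd) (Or.inl hV)
  obtain ⟨-, h1⟩ := hcert V C hC hord Dm.f Dm.isNewformOf ϖ hϖ'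
  rw [if_pos heven, PowerSeries.coeff_C_mul] at h1
  -- pGZ at rank 1
  obtain ⟨hmw, -⟩ := hGZK W (by rw [hr])
  have hr1 : W.mordellWeilRank = 1 := by rw [hmw, hr]
  have hVW : ∃ C : VariableChange ℚ, C • V.quadraticTwist (p : ℚ) = W := ⟨C, by rw [← hps]; exact hC⟩
  obtain ⟨u, q, hLq, hgz⟩ := hGZ V hp4 hVW hV Dm.isNewformOf ϖ hϖ
  rw [hr1, pow_one] at hgz
  -- Schneider from the (strong ⟹ weak) certificate
  have hS : SchneiderConjecture Dh :=
    (hX.schneider_and_padicVal_identity_rankOne_of_wuthrichHalf_of_cert hWu hmodD hGZK hp5 he hr hcert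
      hB).1
  have hq0 : q ≠ 0 := by
    rintro rfl
    rw [Rat.cast_zero, zero_mul, zero_mul] at hLq
    exact W.leadingLCoeff_ne_zero_holds (hmod W) hLq
  have hqQ : ((q : ℚ) : ℚ_[p]) ≠ 0 := by exact_mod_cast hq0
  have hu0 : ((u : ℤ_[p]) : ℚ_[p]) ≠ 0 := coe_units_ne_zero p u
  have hReg : padicRegulator Dh ≠ 0 := hS
  obtain ⟨w, hw⟩ := exists_unit_padicLog_cyclotomicGenerator (p := p) (by omega)
  have hpQ : (p : ℚ_[p]) ≠ 0 := by exact_mod_cast hpP.ne_zero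
  have hlog0 : padicLog p (cyclotomicGenerator p : ℚ_[p]) ≠ 0 := by
    rw [hw]; exact mul_ne_zero hpQ (coe_units_ne_zero p w)
  have hlogv : (padicLog p (cyclotomicGenerator p : ℚ_[p])).valuation = 1 := by
    rw [hw, Padic.valuation_mul hpQ (coe_units_ne_zero p w), Padic.valuation_p,
      valuation_coe_units_eq_zero, add_zero]
  have hx0 : (ϖ : ℚ_[p]) * PowerSeries.coeff 1
      (padicLFunctionBranch Dm.f ((unitRoot V p : ℤ_[p]) : ℚ_[p]) (p / 2)) ≠ 0 := by
    intro h0; rw [h0, norm_zero] at h1; exact zero_ne_one h1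
  have hxv : ((ϖ : ℚ_[p]) * PowerSeries.coeff 1
      (padicLFunctionBranch Dm.f ((unitRoot V p : ℤ_[p]) : ℚ_[p]) (p / 2))).valuation = 0 := by
    have := Padic.norm_eq_zpow_neg_valuation hx0
    rw [h1] at this
    have h' : ((p : ℝ) ^ (-((ϖ : ℚ_[p]) * PowerSeries.coeff 1
        (padicLFunctionBranch Dm.f ((unitRoot V p : ℤ_[p]) : ℚ_[p]) (p / 2))).valuation)) = 1 :=
      this.symm
    have hp1 : (1 : ℝ) < p := by exact_mod_cast hpP.one_lt
    have := zpow_right_injective₀ (by positivity) hp1.ne' (h'.trans (zpow_zero _).symm)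
    linarith
  have hval := congrArg Padic.valuation hgz
  rw [Padic.valuation_mul hx0 hlog0, hxv, hlogv, Padic.valuation_mul (mul_ne_zero hu0 hqQ) hReg,
    Padic.valuation_mul hu0 hqQ, valuation_coe_units_eq_zero, zero_add, Padic.valuation_ratCast] at hval
  exact (hX.bsdp_iff_padicVal_rankOne_of_wuthrichHalf_of_cert hWu hmodD hGZK hmod hp5 he hr hna hcert
    hB hLq).mpr (by linarith)

/-! ### §3 On the unit-certified rows the typed branch `p`-adic Gross–Zagier IS `BSD(E,p)` -/

/-- **X3♯(G-ord) ∩ `I₀*`, `p ≡ 1 (mod 4)`, `p ≥ 5`, `E` non-CM, `r_an = 1`, non-anomalous,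
UNIT certificate, `Dh` a (B)-datum: `BranchPAdicGrossZagierAt W p Dh ↔ BSDp W p`.** (⟸: `BSD(E,p)`
gives `ord(q·Reg_p(Dh)) = 1 = ord(ϖ·[T¹]B·log_p γ)` for every admissible `(V, f, ϖ)` — the unit
certificate fixes `ord(ϖ[T¹]B) = 0`, `GordRankOneKatoCertificateBSD` fixes `ord q + ord Reg_p = 1` — so
the quotient is a unit of `ℤ_p`.) The typed `p`-adic Gross–Zagier formula at the additive prime
(RESIDUAL-MAP O7-ord, OPEN) and the `p`-part of BSD are ONE statement on these rows.
[cite: Wuthrich2014, Thm. 16 (p. 397)] [cite: Delbourgo2002, Theorem (A), (B) (p. 40)]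
[cite: PerrinRiou1987, §1.4 (shape)] [cite: Miller2011LMS, Def. 1.1] -/
theorem ClassX3Gord.branchPAdicGrossZagierAt_iff_bsdp_of_wuthrichHalf_of_cert
    (hWu : Wuthrich2014.thm16_halfEigenCharIdeal_dvd_cyclotomicPrime)
    (hmodD : nonempty_modularParametrizationData)
    (hGZK : rank_eq_analyticRank_of_analyticRank_le_one) (hmod : hasEntireLFunction_rat)
    (hX : ClassX3Gord W p) (hp4 : p % 4 = 1) (hp5 : 5 ≤ p)
    (he : semistabilityIndex W p = 2) (hr : W.analyticRank = 1)
    (hna : ReductionNonAnomalous W p) (hcert : BranchUnitCertificateAt W p)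
    {Dh : PAdicHeightData W p} (hB : LeadingTermClauses W p Dh) :
    BranchPAdicGrossZagierAt W p Dh ↔ BSDp W p := by
  refine ⟨fun hGZ ↦ hX.bsdp_rankOne_of_wuthrichHalf_of_cert_of_branchPAdicGrossZagier hWu hmodD hGZK hmod
    hp4 hp5 he hr hna hcert hB hGZ, fun hbsd ↦ ?_⟩
  have hpP : p.Prime := hp.out
  obtain ⟨-, heven⟩ := pStar_eq_and_even_of_mod_four_eq_one (p := p) hp4
  -- rank one bookkeeping
  obtain ⟨hmw, hfinSha⟩ := hGZK W (by rw [hr])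
  have hr1 : W.mordellWeilRank = 1 := by rw [hmw, hr]
  haveI : Finite W.sha := hfinSha
  -- `q` with `L'(E,1) = q Ω Reg_∞` (from `#Ш_an` rational under BSD, or directly from file 3's datum)
  have hS : SchneiderConjecture Dh :=
    (hX.schneider_and_padicVal_identity_rankOne_of_wuthrichHalf_of_cert hWu hmodD hGZK hp5 he hr hcert
      hB).1
  intro V iV iVm N _ f hp4' hVW hV hf ϖ hϖ
  obtain ⟨C, hC⟩ := hVW
  have hps : ((-1 : ℚ) ^ (p / 2) * (p : ℚ)) = (p : ℚ) := by rw [heven.neg_one_pow, one_mul]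
  have hC' : C • V.quadraticTwist ((-1 : ℚ) ^ (p / 2) * p) = W := by rw [hps]; exact hC
  have hϖ' : (if Even (p / 2) then (ϖ : ℝ) * V.realPeriodRat = plusPeriod f
      else (ϖ : ℝ) * V.imaginaryPeriodRat = minusPeriod f) := by rw [if_pos heven]; exact hϖ
  have hord : IsOrdinaryAt V p :=
    isOrdinaryAt_of_goodOrd_or_mult_of_model_twist W V (pStar_ne_zero p) ⟨C, hC'⟩
      (padicValRat_j_nonneg_of_typeGOrd W p hX.typeGOrd) (Or.inl hV)
  obtain ⟨-, h1⟩ := hcert V C hC' hord f hf ϖ hϖ'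
  rw [if_pos heven, PowerSeries.coeff_C_mul] at h1
  -- `#Ш_an = q'·…` : get `q` from BSD(E,p)'s rationality via `shaAn`
  obtain ⟨s, hs, -⟩ := missingPPartAt_of_bsdp W p hbsd
  -- define q := s·∏c/#T²; then L' = q Ω Reg_∞
  have hΩpos : 0 < W.realPeriodRat := W.realPeriodRat_pos_holds
  have hT0 : W.torsionOrder ≠ 0 := (W.torsionOrder_pos_holds).ne'
  have hPpos : 0 < W.tamagawaProduct := W.tamagawaProduct_pos_holds
  have hRpos : 0 < W.regulator := regulator_pos_holds W
  set q : ℚ := s * (W.tamagawaProduct : ℚ) / (W.torsionOrder : ℚ) ^ 2 with hq_def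
  have hLq : W.leadingLCoeff = (q : ℂ) * (W.realPeriodRat : ℂ) * (W.regulator : ℂ) := by
    have hΩC : (W.realPeriodRat : ℂ) ≠ 0 := by exact_mod_cast hΩpos.ne'
    have hTC : (W.torsionOrder : ℂ) ≠ 0 := by exact_mod_cast hT0
    have hPC : (W.tamagawaProduct : ℂ) ≠ 0 := by exact_mod_cast hPpos.ne'
    have hRC : (W.regulator : ℂ) ≠ 0 := by exact_mod_cast hRpos.ne'
    have h := hs
    rw [shaAn_def, div_eq_iff (mul_ne_zero (mul_ne_zero hΩC hPC) hRC)] at h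
    rw [hq_def]
    push_cast
    field_simp
    linear_combination h
  -- file 3: `ord q + ord Reg_p = 1`
  have hvq : padicValRat p q + (padicRegulator Dh).valuation = 1 :=
    (hX.bsdp_iff_padicVal_rankOne_of_wuthrichHalf_of_cert hWu hmodD hGZK hmod hp5 he hr hna hcert hB
      hLq).mp hbsd
  -- valuations of both sides
  have hq0 : q ≠ 0 := by
    rintro h0
    rw [h0, Rat.cast_zero, zero_mul, zero_mul] at hLq
    exact W.leadingLCoeff_ne_zero_holds (hmod W) hLq
  have hqQ : ((q : ℚ) : ℚ_[p]) ≠ 0 := by exact_mod_cast hq0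
  have hReg : padicRegulator Dh ≠ 0 := hS
  obtain ⟨w, hw⟩ := exists_unit_padicLog_cyclotomicGenerator (p := p) (by omega)
  have hpQ : (p : ℚ_[p]) ≠ 0 := by exact_mod_cast hpP.ne_zero
  have hlog0 : padicLog p (cyclotomicGenerator p : ℚ_[p]) ≠ 0 := by
    rw [hw]; exact mul_ne_zero hpQ (coe_units_ne_zero p w)
  have hlogv : (padicLog p (cyclotomicGenerator p : ℚ_[p])).valuation = 1 := by
    rw [hw, Padic.valuation_mul hpQ (coe_units_ne_zero p w), Padic.valuation_p,
      valuation_coe_units_eq_zero, add_zero]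
  have hx0 : (ϖ : ℚ_[p]) * PowerSeries.coeff 1
      (padicLFunctionBranch f ((unitRoot V p : ℤ_[p]) : ℚ_[p]) (p / 2)) ≠ 0 := by
    intro h0; rw [h0, norm_zero] at h1; exact zero_ne_one h1
  have hxv : ((ϖ : ℚ_[p]) * PowerSeries.coeff 1
      (padicLFunctionBranch f ((unitRoot V p : ℤ_[p]) : ℚ_[p]) (p / 2))).valuation = 0 := by
    have := Padic.norm_eq_zpow_neg_valuation hx0
    rw [h1] at this
    have h' : ((p : ℝ) ^ (-((ϖ : ℚ_[p]) * PowerSeries.coeff 1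
        (padicLFunctionBranch f ((unitRoot V p : ℤ_[p]) : ℚ_[p]) (p / 2))).valuation)) = 1 :=
      this.symm
    have hp1 : (1 : ℝ) < p := by exact_mod_cast hpP.one_lt
    have := zpow_right_injective₀ (by positivity) hp1.ne' (h'.trans (zpow_zero _).symm)
    linarith
  -- the quotient `x := (ϖ[T¹]B·log γ)/(q·Reg_p)` is a unit
  set num : ℚ_[p] := (ϖ : ℚ_[p]) * PowerSeries.coeff 1
      (padicLFunctionBranch f ((unitRoot V p : ℤ_[p]) : ℚ_[p]) (p / 2)) *
      padicLog p (cyclotomicGenerator p) with hnum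
  set den : ℚ_[p] := ((q : ℚ) : ℚ_[p]) * padicRegulator Dh with hden
  have hnum0 : num ≠ 0 := mul_ne_zero hx0 hlog0
  have hden0 : den ≠ 0 := mul_ne_zero hqQ hReg
  have hnumv : num.valuation = 1 := by
    rw [hnum, Padic.valuation_mul hx0 hlog0, hxv, hlogv, zero_add]
  have hdenv : den.valuation = 1 := by
    rw [hden, Padic.valuation_mul hqQ hReg, Padic.valuation_ratCast]
    exact hvq
  have hxval : (num / den).valuation = 0 := by
    have hprod : num / den * den = num := div_mul_cancel₀ num hden0
    have hv := congrArg Padic.valuation hprod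
    rw [Padic.valuation_mul (div_ne_zero hnum0 hden0) hden0, hnumv, hdenv] at hv
    linarith
  obtain ⟨u, hu⟩ := exists_units_coe_eq_of_valuation_eq_zero (div_ne_zero hnum0 hden0) hxval
  refine ⟨u, q, hLq, ?_⟩
  have hcancel : num / den * den = num := div_mul_cancel₀ num hden0
  rw [hr1, pow_one, hu]
  simp only [hnum, hden] at hcancel ⊢
  linear_combination -hcancel

end Summit.BirchSwinnertonDyer.Rank1Residual.Additive

end
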